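import Summits.CriticalPhenomena.PercolationContinuityZ3.Theorems.PercNearOneGluingNoHeavyLowerTailThreePartitionRowColumn

/-!
# `NoHeavyLowerTail` (crux stmt-CriticalPhenomena-4575): Conjecture V DECOUPLES — the columns are independent Kleitman
# systems; the only row/column interaction is which positive units the `T3⁻` units take

Support file (lineage `prim-bnk-2`, generation 29; `--supports stmt-CriticalPhenomena-4575`; memo
`run/shared/lean/prim/prim-l12/FROM-prim-bnk-2-g29-DECOUPLED-HALL.md`).  No `sorry`, standard axioms; the only unproved
statement is the `@[conjecture]`-tagged `DecoupledVOrder`, used as an explicit hypothesis.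

Write the kernel of Conjecture V (`…ThreePartitionVOrder`, `vSumT`) in typed units (memo g23 §10, `…ThreePartitionRowColumn`):
`K = T1⁺ − T1⁻ + T2⁺ − T2⁻ + T3⁺ − T3⁻` with the six 0/1 indicators
  `T1⁺ = [a∈𝒱𝒲][c∉𝒱]`, `T1⁻ = [a∈𝒲∖𝒱][c∈𝒱]`, `T2⁺ = [a∈𝒱𝒲][c∉𝒲]`, `T2⁻ = [a∈𝒱∖𝒲][c∈𝒲]`,
  `T3⁺ = [c∈𝒱∖𝒲][b∈𝒲]`, `T3⁻ = [c∈𝒱𝒲][b∉𝒲]`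
(`vSumT_eq_units`).  The `T1` and `T2` units are COLUMN units (they are moved by growing the first copy `a` with `b` fixed),
the `T3` units are ROW units.  A family `𝒰` of pairs is COLUMN-CLOSED if `(a,b) ∈ 𝒰, a ⊆ a' ⟹ (a',b) ∈ 𝒰`
(`isUpperSet_colSection_of_isUpperSet`: every up-set of the copy order is column-closed, not conversely; in the statements a column-closed
family `𝒰` is given by the hypothesis that all its column sections `{a : (a,b) ∈ 𝒰}` are up-sets).

* **`colNegUnits_le_colPosUnits`** (PROVED, two column moves): on every column-closed family the negative column units are
  outnumbered by the positive column units — "every column is a self-sufficient Kleitman system".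
* **`DecoupledVOrder`** (this work, OPEN, census below): for every up-set `𝒳` of the copy order and every column-closed `𝒰`,
  `T3⁻(𝒳) + T1⁻(𝒰) + T2⁻(𝒰) ≤ (T1⁺ + T2⁺ + T3⁺)(𝒳 ∪ 𝒰)`.
  The diagonal `𝒰 = 𝒳` is Conjecture V (`vOrderPositivity_of_decoupledVOrder`), so `DecoupledVOrder ⟹` Sahi's `C₃` on product
  measures (`masterFamilyNonneg_three_of_decoupledVOrder`).  It is the Hall condition of the matching discipline "(M3)": every
  column source takes a positive unit INSIDE ITS OWN COLUMN, every `T3⁻` unit takes any positive unit above it; census (memo §1,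
  `code/m3test.c`, `m3census.c`, `h3cut.c`): `m = 3, 4` exhaustive over `(𝒱,𝒲,τ)` (3 200 / 451 584 instances), `m = 5, 6` sampled
  (2·10⁵ / 2·10⁴, random twists), `0` failures; the natural further decouplings are FALSE (separate `T1`/`T2` systems: 48/3 200 at
  `m = 3`; `T3⁻` restricted to one unit per double face: 12/28 224 at `m = 4`).
* **`decoupledVOrder_of_subset` / `decoupledVOrder_of_superset`** (PROVED): `DecoupledVOrder` holds on every NESTED pair (both
  directions) — the column move, Theorem U (`triT_thmU_le`) and Theorem A (`triT_robust_le_b`) of generations 23–25 already give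
  the decoupled form, not only Conjecture V.
[this work]
-/

namespace Summit.CriticalPhenomena.PercolationContinuityZ3.Theorems.ThreePartition

open Finset Function
open scoped Classical

noncomputable section

variable {ι : Type*} [Fintype ι]

/-! ## The six unit counts over a family of pairs -/

/-- Positive COLUMN units over a family `𝒴` of pairs `(a,b)`: `T1⁺ + T2⁺ = #(a∈𝒱𝒲, c∉𝒱) + #(a∈𝒱𝒲, c∉𝒲)` (a double
face `(a∈𝒱𝒲 | · | c∉𝒱∪𝒲)` carries two). [this work] -/
def colPosUnits (τ : Set ι) (𝒱 𝒲 : Set (Set ι)) (𝒴 : Set (Set ι × Set ι)) : ℕ :=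
  triT τ (fun a b c => (a, b) ∈ 𝒴 ∧ (a ∈ 𝒱 ∧ a ∈ 𝒲) ∧ c ∉ 𝒱)
    + triT τ (fun a b c => (a, b) ∈ 𝒴 ∧ (a ∈ 𝒱 ∧ a ∈ 𝒲) ∧ c ∉ 𝒲)

/-- Negative COLUMN units over `𝒴`: `T1⁻ + T2⁻ = #(a∈𝒲∖𝒱, c∈𝒱) + #(a∈𝒱∖𝒲, c∈𝒲)`. [this work] -/
def colNegUnits (τ : Set ι) (𝒱 𝒲 : Set (Set ι)) (𝒴 : Set (Set ι × Set ι)) : ℕ :=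
  triT τ (fun a b c => (a, b) ∈ 𝒴 ∧ (a ∈ 𝒲 ∧ a ∉ 𝒱) ∧ c ∈ 𝒱)
    + triT τ (fun a b c => (a, b) ∈ 𝒴 ∧ (a ∈ 𝒱 ∧ a ∉ 𝒲) ∧ c ∈ 𝒲)

/-- Positive ROW units over `𝒴`: `T3⁺ = #(c∈𝒱∖𝒲, b∈𝒲)`. [this work] -/
def rowPosUnits (τ : Set ι) (𝒱 𝒲 : Set (Set ι)) (𝒴 : Set (Set ι × Set ι)) : ℕ :=
  triT τ (fun a b c => (a, b) ∈ 𝒴 ∧ (c ∈ 𝒱 ∧ c ∉ 𝒲) ∧ b ∈ 𝒲)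

/-- Negative ROW units over `𝒴`: `T3⁻ = #(c∈𝒱𝒲, b∉𝒲)`. [this work] -/
def rowNegUnits (τ : Set ι) (𝒱 𝒲 : Set (Set ι)) (𝒴 : Set (Set ι × Set ι)) : ℕ :=
  triT τ (fun a b c => (a, b) ∈ 𝒴 ∧ (c ∈ 𝒱 ∧ c ∈ 𝒲) ∧ b ∉ 𝒲)

/-- All positive units over `𝒴`: `T1⁺ + T2⁺ + T3⁺`. [this work] -/
def posUnits (τ : Set ι) (𝒱 𝒲 : Set (Set ι)) (𝒴 : Set (Set ι × Set ι)) : ℕ :=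
  colPosUnits τ 𝒱 𝒲 𝒴 + rowPosUnits τ 𝒱 𝒲 𝒴

/-- **`vSumT` in units**: `vSumT = (T1⁺ + T2⁺ + T3⁺) − (T1⁻ + T2⁻ + T3⁻)`. [this work] -/
theorem vSumT_eq_units (τ : Set ι) (𝒱 𝒲 : Set (Set ι)) (𝒳 : Set (Set ι × Set ι)) :
    vSumT τ 𝒱 𝒲 𝒳 = (posUnits τ 𝒱 𝒲 𝒳 : ℤ) - (colNegUnits τ 𝒱 𝒲 𝒳 + rowNegUnits τ 𝒱 𝒲 𝒳 : ℕ) := by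
  -- `#(a∈𝒱𝒲) = #(a∈𝒱𝒲, c∈𝒱) + T1⁺` and `#(a∈𝒲, c∈𝒱) = #(a∈𝒱𝒲, c∈𝒱) + T1⁻`
  have s1 := triT_and_add_triT_and_not τ (fun a b _ => (a, b) ∈ 𝒳 ∧ a ∈ 𝒱 ∧ a ∈ 𝒲) (fun _ _ c => c ∈ 𝒱)
  have s2 := triT_and_add_triT_and_not τ (fun a b c => (a, b) ∈ 𝒳 ∧ a ∈ 𝒲 ∧ c ∈ 𝒱) (fun a _ _ => a ∈ 𝒱)
  have e2 : triT τ (fun a b c => ((a, b) ∈ 𝒳 ∧ a ∈ 𝒲 ∧ c ∈ 𝒱) ∧ a ∈ 𝒱) =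
      triT τ (fun a b c => ((a, b) ∈ 𝒳 ∧ a ∈ 𝒱 ∧ a ∈ 𝒲) ∧ c ∈ 𝒱) := triT_congr fun a b c => by tauto
  have e2' : triT τ (fun a b c => ((a, b) ∈ 𝒳 ∧ a ∈ 𝒲 ∧ c ∈ 𝒱) ∧ ¬ a ∈ 𝒱) =
      triT τ (fun a b c => (a, b) ∈ 𝒳 ∧ (a ∈ 𝒲 ∧ a ∉ 𝒱) ∧ c ∈ 𝒱) := triT_congr fun a b c => by tauto
  have e1' : triT τ (fun a b c => ((a, b) ∈ 𝒳 ∧ a ∈ 𝒱 ∧ a ∈ 𝒲) ∧ ¬ c ∈ 𝒱) =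
      triT τ (fun a b c => (a, b) ∈ 𝒳 ∧ (a ∈ 𝒱 ∧ a ∈ 𝒲) ∧ c ∉ 𝒱) := triT_congr fun a b c => by tauto
  -- `#(a∈𝒱𝒲) = #(a∈𝒱𝒲, c∈𝒲) + T2⁺` and `#(a∈𝒱, c∈𝒲) = #(a∈𝒱𝒲, c∈𝒲) + T2⁻`
  have s3 := triT_and_add_triT_and_not τ (fun a b _ => (a, b) ∈ 𝒳 ∧ a ∈ 𝒱 ∧ a ∈ 𝒲) (fun _ _ c => c ∈ 𝒲)
  have s4 := triT_and_add_triT_and_not τ (fun a b c => (a, b) ∈ 𝒳 ∧ a ∈ 𝒱 ∧ c ∈ 𝒲) (fun a _ _ => a ∈ 𝒲)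
  have e4 : triT τ (fun a b c => ((a, b) ∈ 𝒳 ∧ a ∈ 𝒱 ∧ c ∈ 𝒲) ∧ a ∈ 𝒲) =
      triT τ (fun a b c => ((a, b) ∈ 𝒳 ∧ a ∈ 𝒱 ∧ a ∈ 𝒲) ∧ c ∈ 𝒲) := triT_congr fun a b c => by tauto
  have e4' : triT τ (fun a b c => ((a, b) ∈ 𝒳 ∧ a ∈ 𝒱 ∧ c ∈ 𝒲) ∧ ¬ a ∈ 𝒲) =
      triT τ (fun a b c => (a, b) ∈ 𝒳 ∧ (a ∈ 𝒱 ∧ a ∉ 𝒲) ∧ c ∈ 𝒲) := triT_congr fun a b c => by tauto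
  have e3' : triT τ (fun a b c => ((a, b) ∈ 𝒳 ∧ a ∈ 𝒱 ∧ a ∈ 𝒲) ∧ ¬ c ∈ 𝒲) =
      triT τ (fun a b c => (a, b) ∈ 𝒳 ∧ (a ∈ 𝒱 ∧ a ∈ 𝒲) ∧ c ∉ 𝒲) := triT_congr fun a b c => by tauto
  -- `#(c∈𝒱, b∈𝒲) = #(c∈𝒱𝒲, b∈𝒲) + T3⁺` and `#(c∈𝒱𝒲) = #(c∈𝒱𝒲, b∈𝒲) + T3⁻`
  have s5 := triT_and_add_triT_and_not τ (fun a b c => (a, b) ∈ 𝒳 ∧ c ∈ 𝒱 ∧ b ∈ 𝒲) (fun _ _ c => c ∈ 𝒲)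
  have s6 := triT_and_add_triT_and_not τ (fun a b c => (a, b) ∈ 𝒳 ∧ c ∈ 𝒱 ∧ c ∈ 𝒲) (fun _ b _ => b ∈ 𝒲)
  have e6 : triT τ (fun a b c => ((a, b) ∈ 𝒳 ∧ c ∈ 𝒱 ∧ c ∈ 𝒲) ∧ b ∈ 𝒲) =
      triT τ (fun a b c => ((a, b) ∈ 𝒳 ∧ c ∈ 𝒱 ∧ b ∈ 𝒲) ∧ c ∈ 𝒲) := triT_congr fun a b c => by tauto
  have e6' : triT τ (fun a b c => ((a, b) ∈ 𝒳 ∧ c ∈ 𝒱 ∧ c ∈ 𝒲) ∧ ¬ b ∈ 𝒲) =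
      triT τ (fun a b c => (a, b) ∈ 𝒳 ∧ (c ∈ 𝒱 ∧ c ∈ 𝒲) ∧ b ∉ 𝒲) := triT_congr fun a b c => by tauto
  have e5' : triT τ (fun a b c => ((a, b) ∈ 𝒳 ∧ c ∈ 𝒱 ∧ b ∈ 𝒲) ∧ ¬ c ∈ 𝒲) =
      triT τ (fun a b c => (a, b) ∈ 𝒳 ∧ (c ∈ 𝒱 ∧ c ∉ 𝒲) ∧ b ∈ 𝒲) := triT_congr fun a b c => by tauto
  rw [e1'] at s1
  rw [e2, e2'] at s2
  rw [e3'] at s3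
  rw [e4, e4'] at s4
  rw [e5'] at s5
  rw [e6, e6'] at s6
  unfold vSumT posUnits colPosUnits rowPosUnits colNegUnits rowNegUnits
  push_cast
  have s1' := congrArg (fun n : ℕ => (n : ℤ)) s1
  have s2' := congrArg (fun n : ℕ => (n : ℤ)) s2
  have s3' := congrArg (fun n : ℕ => (n : ℤ)) s3
  have s4' := congrArg (fun n : ℕ => (n : ℤ)) s4
  have s5' := congrArg (fun n : ℕ => (n : ℤ)) s5
  have s6' := congrArg (fun n : ℕ => (n : ℤ)) s6
  simp only [Nat.cast_add] at s1' s2' s3' s4' s5' s6'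
  linarith

/-! ## Column-closed families; the columns are self-sufficient -/

omit [Fintype ι] in
/-- Every up-set of the copy order is COLUMN-CLOSED: all its column sections `{a : (a,b) ∈ 𝒳}` (`b` fixed) are up-sets.
(A column-closed family — one closed under growing the first copy with the second copy fixed, i.e. under the column moves
`c → a` only — need not be an up-set of the copy order.) [this work] -/
theorem isUpperSet_colSection_of_isUpperSet {𝒳 : Set (Set ι × Set ι)} (h𝒳 : IsUpperSet 𝒳) (b : Set ι) :
    IsUpperSet {a : Set ι | (a, b) ∈ 𝒳} :=
  fun _ _ hle hx => h𝒳 (Prod.mk_le_mk.2 ⟨hle, le_rfl⟩) hx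

/-- **The columns are self-sufficient**: on every column-closed family `𝒰` the negative column units are outnumbered by
the positive ones, `T1⁻(𝒰) + T2⁻(𝒰) ≤ T1⁺(𝒰) + T2⁺(𝒰)` — two column moves (`triT_col_le`: fibrewise Harris / Kleitman on each
column `b = const`), one for `𝒱` on the sections `{a∈𝒲 : (a,b)∈𝒰}` and one for `𝒲` on `{a∈𝒱 : (a,b)∈𝒰}`. [this work] -/
theorem colNegUnits_le_colPosUnits (τ : Set ι) {𝒱 𝒲 : Set (Set ι)} {𝒰 : Set (Set ι × Set ι)}
    (h𝒱 : IsUpperSet 𝒱) (h𝒲 : IsUpperSet 𝒲) (h𝒰 : ∀ b : Set ι, IsUpperSet {a : Set ι | (a, b) ∈ 𝒰}) :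
    colNegUnits τ 𝒱 𝒲 𝒰 ≤ colPosUnits τ 𝒱 𝒲 𝒰 := by
  -- column move for `𝒱` on the sections `{a : (a,b) ∈ 𝒰, a ∈ 𝒲}`
  have hA1 : ∀ b : Set ι, IsUpperSet {a : Set ι | (a, b) ∈ 𝒰 ∧ a ∈ 𝒲} :=
    fun b a a' hle ha => ⟨h𝒰 b hle ha.1, h𝒲 hle ha.2⟩
  have m1 := triT_col_le τ (fun b => {a : Set ι | (a, b) ∈ 𝒰 ∧ a ∈ 𝒲}) hA1 h𝒱
  have m1' : triT τ (fun a b c => (a, b) ∈ 𝒰 ∧ a ∈ 𝒲 ∧ c ∈ 𝒱) ≤ triT τ (fun a b _ => (a, b) ∈ 𝒰 ∧ a ∈ 𝒱 ∧ a ∈ 𝒲) := by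
    refine le_trans (le_of_eq (triT_congr fun a b c => ?_)) (le_trans m1 (le_of_eq (triT_congr fun a b c => ?_)))
    · simp only [Set.mem_setOf_eq]; tauto
    · simp only [Set.mem_setOf_eq]; tauto
  -- column move for `𝒲` on the sections `{a : (a,b) ∈ 𝒰, a ∈ 𝒱}`
  have hA2 : ∀ b : Set ι, IsUpperSet {a : Set ι | (a, b) ∈ 𝒰 ∧ a ∈ 𝒱} :=
    fun b a a' hle ha => ⟨h𝒰 b hle ha.1, h𝒱 hle ha.2⟩
  have m2 := triT_col_le τ (fun b => {a : Set ι | (a, b) ∈ 𝒰 ∧ a ∈ 𝒱}) hA2 h𝒲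
  have m2' : triT τ (fun a b c => (a, b) ∈ 𝒰 ∧ a ∈ 𝒱 ∧ c ∈ 𝒲) ≤ triT τ (fun a b _ => (a, b) ∈ 𝒰 ∧ a ∈ 𝒱 ∧ a ∈ 𝒲) := by
    refine le_trans (le_of_eq (triT_congr fun a b c => ?_)) (le_trans m2 (le_of_eq (triT_congr fun a b c => ?_)))
    · simp only [Set.mem_setOf_eq]; tauto
    · simp only [Set.mem_setOf_eq]; tauto
  -- remove the common parts `#(a∈𝒱𝒲, c∈𝒱)` resp. `#(a∈𝒱𝒲, c∈𝒲)`
  have s1 := triT_and_add_triT_and_not τ (fun a b _ => (a, b) ∈ 𝒰 ∧ a ∈ 𝒱 ∧ a ∈ 𝒲) (fun _ _ c => c ∈ 𝒱)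
  have s2 := triT_and_add_triT_and_not τ (fun a b c => (a, b) ∈ 𝒰 ∧ a ∈ 𝒲 ∧ c ∈ 𝒱) (fun a _ _ => a ∈ 𝒱)
  have e2 : triT τ (fun a b c => ((a, b) ∈ 𝒰 ∧ a ∈ 𝒲 ∧ c ∈ 𝒱) ∧ a ∈ 𝒱) =
      triT τ (fun a b c => ((a, b) ∈ 𝒰 ∧ a ∈ 𝒱 ∧ a ∈ 𝒲) ∧ c ∈ 𝒱) := triT_congr fun a b c => by tauto
  have e2' : triT τ (fun a b c => ((a, b) ∈ 𝒰 ∧ a ∈ 𝒲 ∧ c ∈ 𝒱) ∧ ¬ a ∈ 𝒱) =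
      triT τ (fun a b c => (a, b) ∈ 𝒰 ∧ (a ∈ 𝒲 ∧ a ∉ 𝒱) ∧ c ∈ 𝒱) := triT_congr fun a b c => by tauto
  have e1' : triT τ (fun a b c => ((a, b) ∈ 𝒰 ∧ a ∈ 𝒱 ∧ a ∈ 𝒲) ∧ ¬ c ∈ 𝒱) =
      triT τ (fun a b c => (a, b) ∈ 𝒰 ∧ (a ∈ 𝒱 ∧ a ∈ 𝒲) ∧ c ∉ 𝒱) := triT_congr fun a b c => by tauto
  have s3 := triT_and_add_triT_and_not τ (fun a b _ => (a, b) ∈ 𝒰 ∧ a ∈ 𝒱 ∧ a ∈ 𝒲) (fun _ _ c => c ∈ 𝒲)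
  have s4 := triT_and_add_triT_and_not τ (fun a b c => (a, b) ∈ 𝒰 ∧ a ∈ 𝒱 ∧ c ∈ 𝒲) (fun a _ _ => a ∈ 𝒲)
  have e4 : triT τ (fun a b c => ((a, b) ∈ 𝒰 ∧ a ∈ 𝒱 ∧ c ∈ 𝒲) ∧ a ∈ 𝒲) =
      triT τ (fun a b c => ((a, b) ∈ 𝒰 ∧ a ∈ 𝒱 ∧ a ∈ 𝒲) ∧ c ∈ 𝒲) := triT_congr fun a b c => by tauto
  have e4' : triT τ (fun a b c => ((a, b) ∈ 𝒰 ∧ a ∈ 𝒱 ∧ c ∈ 𝒲) ∧ ¬ a ∈ 𝒲) =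
      triT τ (fun a b c => (a, b) ∈ 𝒰 ∧ (a ∈ 𝒱 ∧ a ∉ 𝒲) ∧ c ∈ 𝒲) := triT_congr fun a b c => by tauto
  have e3' : triT τ (fun a b c => ((a, b) ∈ 𝒰 ∧ a ∈ 𝒱 ∧ a ∈ 𝒲) ∧ ¬ c ∈ 𝒲) =
      triT τ (fun a b c => (a, b) ∈ 𝒰 ∧ (a ∈ 𝒱 ∧ a ∈ 𝒲) ∧ c ∉ 𝒲) := triT_congr fun a b c => by tauto
  rw [e1'] at s1
  rw [e2, e2'] at s2
  rw [e3'] at s3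
  rw [e4, e4'] at s4
  unfold colNegUnits colPosUnits
  omega

/-! ## The decoupled conjecture and what it gives -/

/-- **DECOUPLED CONJECTURE V** (this work; OPEN).  For every finite ground set, every twist `τ`, all up-sets `𝒱, 𝒲`, every
up-set `𝒳` of the copy order and every COLUMN-CLOSED family `𝒰`:
  `T3⁻(𝒳) + T1⁻(𝒰) + T2⁻(𝒰) ≤ (T1⁺ + T2⁺ + T3⁺)(𝒳 ∪ 𝒰)`.
It is the Hall condition of the matching discipline in which every negative COLUMN unit takes a positive unit inside its own
column (`b` fixed, `a` grows) and every negative ROW unit `T3⁻` takes any positive unit above it in the copy order; the diagonal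
`𝒰 = 𝒳` is Conjecture V (`vOrderPositivity_of_decoupledVOrder`).  Sharper census-clean forms (memo §1): the `T3⁻` units may be
confined to `T3⁺` row-internally plus the double faces `D = (a∈𝒱𝒲|·|c∉𝒱∪𝒲)` anywhere above; equivalently
`|T3⁻∩𝒳| − |T3⁺∩𝒳| ≤ Σ_b μ_b(D∩𝒳_b)` with `μ_b` the polymatroid "spare capacity on `D`" of column `b`'s pooled Kleitman system.
Census (`code/m3test.c`, `m3census.c`, `h3cut.c`): `m = 3, 4` exhaustive over `(𝒱,𝒲,τ)` (3 200 / 451 584), `m = 5, 6` sampled with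
random twists (2·10⁵ / 2·10⁴): `0` failures.  Holds on all nested pairs (`decoupledVOrder_of_subset`, `decoupledVOrder_of_superset`)
and on pairs with disjoint supports (memo §2, paper).  An obligation of our theories, never a fact: use as
`(h : DecoupledVOrder)`. [status: open] -/
@[conjecture] def DecoupledVOrder : Prop :=
  ∀ (ι : Type) [Fintype ι] (τ : Set ι) (𝒱 𝒲 : Set (Set ι)) (𝒳 𝒰 : Set (Set ι × Set ι)),
    IsUpperSet 𝒱 → IsUpperSet 𝒲 → IsUpperSet 𝒳 → (∀ b : Set ι, IsUpperSet {a : Set ι | (a, b) ∈ 𝒰}) →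
      rowNegUnits τ 𝒱 𝒲 𝒳 + colNegUnits τ 𝒱 𝒲 𝒰 ≤ posUnits τ 𝒱 𝒲 (𝒳 ∪ 𝒰)

/-- **The decoupled conjecture implies Conjecture V** (take `𝒰 = 𝒳`). [this work] -/
theorem vOrderPositivity_of_decoupledVOrder (h : DecoupledVOrder) : VOrderPositivity := by
  intro ι _ τ 𝒱 𝒲 𝒳 h𝒱 h𝒲 h𝒳
  have hd := h ι τ 𝒱 𝒲 𝒳 𝒳 h𝒱 h𝒲 h𝒳 (isUpperSet_colSection_of_isUpperSet h𝒳)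
  rw [Set.union_self] at hd
  rw [vSumT_eq_units]
  have hd' := Int.ofNat_le.2 hd
  simp only [Nat.cast_add] at hd'
  push_cast
  linarith

/-- **The decoupled conjecture implies Sahi's `C₃` on every product measure** (`MasterFamilyNonneg 3` = Kahn's Conjecture 5).
[this work] -/
theorem masterFamilyNonneg_three_of_decoupledVOrder (h : DecoupledVOrder) : MasterFamilyNonneg 3 :=
  masterFamilyNonneg_three_of_vOrderPositivity (vOrderPositivity_of_decoupledVOrder h)

/-! ## The decoupled conjecture on nested pairs -/

/-- Monotonicity of the positive unit count in the family. [this work] -/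
theorem posUnits_mono (τ : Set ι) (𝒱 𝒲 : Set (Set ι)) {𝒴 𝒴' : Set (Set ι × Set ι)} (h : 𝒴 ⊆ 𝒴') :
    posUnits τ 𝒱 𝒲 𝒴 ≤ posUnits τ 𝒱 𝒲 𝒴' := by
  unfold posUnits colPosUnits rowPosUnits
  gcongr
  · exact triT_mono τ fun a b c hp => ⟨h hp.1, hp.2⟩
  · exact triT_mono τ fun a b c hp => ⟨h hp.1, hp.2⟩
  · exact triT_mono τ fun a b c hp => ⟨h hp.1, hp.2⟩

/-- **`DecoupledVOrder` holds for `𝒱 ⊆ 𝒲`**: then `T2⁻ = T3⁺ = ∅`, the `T1⁻` units of `𝒰` are absorbed inside their columns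
(`colNegUnits_le_colPosUnits`) and the `T3⁻` units of `𝒳` by Theorem U (`triT_thmU_le`: `#(c∈𝒱, b∉𝒲) ≤ #(a∈𝒱, c∉𝒲) = T2⁺(𝒳)`).
[this work] -/
theorem decoupledVOrder_of_subset (τ : Set ι) {𝒱 𝒲 : Set (Set ι)} {𝒳 𝒰 : Set (Set ι × Set ι)}
    (h𝒱 : IsUpperSet 𝒱) (h𝒲 : IsUpperSet 𝒲) (h𝒳 : IsUpperSet 𝒳) (h𝒰 : ∀ b : Set ι, IsUpperSet {a : Set ι | (a, b) ∈ 𝒰}) (hsub : 𝒱 ⊆ 𝒲) :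
    rowNegUnits τ 𝒱 𝒲 𝒳 + colNegUnits τ 𝒱 𝒲 𝒰 ≤ posUnits τ 𝒱 𝒲 (𝒳 ∪ 𝒰) := by
  -- Theorem U: `T3⁻(𝒳) ≤ T2⁺(𝒳)`
  have hU := triT_thmU_le τ h𝒳 h𝒱 h𝒲
  have r1 : rowNegUnits τ 𝒱 𝒲 𝒳 ≤ triT τ (fun a b c => (a, b) ∈ 𝒳 ∧ (a ∈ 𝒱 ∧ a ∈ 𝒲) ∧ c ∉ 𝒲) := by
    unfold rowNegUnits
    refine le_trans (le_of_eq (triT_congr fun a b c => ?_)) (le_trans hU (le_of_eq (triT_congr fun a b c => ?_)))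
    · exact ⟨fun h => ⟨h.1, h.2.1.1, h.2.2⟩, fun h => ⟨h.1, ⟨h.2.1, hsub h.2.1⟩, h.2.2⟩⟩
    · exact ⟨fun h => ⟨h.1, ⟨h.2.1, hsub h.2.1⟩, h.2.2⟩, fun h => ⟨h.1, h.2.1.1, h.2.2⟩⟩
  have r2 : triT τ (fun a b c => (a, b) ∈ 𝒳 ∧ (a ∈ 𝒱 ∧ a ∈ 𝒲) ∧ c ∉ 𝒲) ≤ colPosUnits τ 𝒱 𝒲 (𝒳 ∪ 𝒰) := by
    unfold colPosUnits
    exact le_add_left (triT_mono τ fun a b c hp => ⟨Set.mem_union_left _ hp.1, hp.2⟩)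
  have c1 := colNegUnits_le_colPosUnits τ h𝒱 h𝒲 h𝒰
  -- the `T2⁻` count vanishes (`a ∈ 𝒱 ∖ 𝒲 = ∅`), so `colNeg 𝒰 = T1⁻(𝒰) ≤ T1⁺(𝒰)`; we only need the cruder split below
  have c0 : triT τ (fun a b c => (a, b) ∈ 𝒰 ∧ (a ∈ 𝒱 ∧ a ∉ 𝒲) ∧ c ∈ 𝒲) = 0 :=
    triT_eq_zero τ fun a b c h => h.2.1.2 (hsub h.2.1.1)
  have p0 : triT τ (fun a b c => (a, b) ∈ 𝒰 ∧ (a ∈ 𝒱 ∧ a ∈ 𝒲) ∧ c ∉ 𝒲) ≤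
      triT τ (fun a b c => (a, b) ∈ 𝒰 ∧ (a ∈ 𝒱 ∧ a ∈ 𝒲) ∧ c ∉ 𝒱) :=
    triT_mono τ fun a b c h => ⟨h.1, h.2.1, fun hc => h.2.2 (hsub hc)⟩
  -- `T1⁻(𝒰) ≤ T1⁺(𝒰)` alone: redo the first column move
  have hA1 : ∀ b : Set ι, IsUpperSet {a : Set ι | (a, b) ∈ 𝒰 ∧ a ∈ 𝒲} :=
    fun b a a' hle ha => ⟨h𝒰 b hle ha.1, h𝒲 hle ha.2⟩
  have m1 := triT_col_le τ (fun b => {a : Set ι | (a, b) ∈ 𝒰 ∧ a ∈ 𝒲}) hA1 h𝒱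
  have m1' : triT τ (fun a b c => (a, b) ∈ 𝒰 ∧ a ∈ 𝒲 ∧ c ∈ 𝒱) ≤ triT τ (fun a b _ => (a, b) ∈ 𝒰 ∧ a ∈ 𝒱 ∧ a ∈ 𝒲) := by
    refine le_trans (le_of_eq (triT_congr fun a b c => ?_)) (le_trans m1 (le_of_eq (triT_congr fun a b c => ?_)))
    · simp only [Set.mem_setOf_eq]; tauto
    · simp only [Set.mem_setOf_eq]; tauto
  have s1 := triT_and_add_triT_and_not τ (fun a b _ => (a, b) ∈ 𝒰 ∧ a ∈ 𝒱 ∧ a ∈ 𝒲) (fun _ _ c => c ∈ 𝒱)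
  have s2 := triT_and_add_triT_and_not τ (fun a b c => (a, b) ∈ 𝒰 ∧ a ∈ 𝒲 ∧ c ∈ 𝒱) (fun a _ _ => a ∈ 𝒱)
  have e2 : triT τ (fun a b c => ((a, b) ∈ 𝒰 ∧ a ∈ 𝒲 ∧ c ∈ 𝒱) ∧ a ∈ 𝒱) =
      triT τ (fun a b c => ((a, b) ∈ 𝒰 ∧ a ∈ 𝒱 ∧ a ∈ 𝒲) ∧ c ∈ 𝒱) := triT_congr fun a b c => by tauto
  have e2' : triT τ (fun a b c => ((a, b) ∈ 𝒰 ∧ a ∈ 𝒲 ∧ c ∈ 𝒱) ∧ ¬ a ∈ 𝒱) =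
      triT τ (fun a b c => (a, b) ∈ 𝒰 ∧ (a ∈ 𝒲 ∧ a ∉ 𝒱) ∧ c ∈ 𝒱) := triT_congr fun a b c => by tauto
  have e1' : triT τ (fun a b c => ((a, b) ∈ 𝒰 ∧ a ∈ 𝒱 ∧ a ∈ 𝒲) ∧ ¬ c ∈ 𝒱) =
      triT τ (fun a b c => (a, b) ∈ 𝒰 ∧ (a ∈ 𝒱 ∧ a ∈ 𝒲) ∧ c ∉ 𝒱) := triT_congr fun a b c => by tauto
  rw [e1'] at s1
  rw [e2, e2'] at s2
  have t1 : triT τ (fun a b c => (a, b) ∈ 𝒰 ∧ (a ∈ 𝒱 ∧ a ∈ 𝒲) ∧ c ∉ 𝒱) ≤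
      triT τ (fun a b c => (a, b) ∈ 𝒳 ∪ 𝒰 ∧ (a ∈ 𝒱 ∧ a ∈ 𝒲) ∧ c ∉ 𝒱) :=
    triT_mono τ fun a b c hp => ⟨Set.mem_union_right _ hp.1, hp.2⟩
  have t2 : triT τ (fun a b c => (a, b) ∈ 𝒳 ∧ (a ∈ 𝒱 ∧ a ∈ 𝒲) ∧ c ∉ 𝒲) ≤
      triT τ (fun a b c => (a, b) ∈ 𝒳 ∪ 𝒰 ∧ (a ∈ 𝒱 ∧ a ∈ 𝒲) ∧ c ∉ 𝒲) :=
    triT_mono τ fun a b c hp => ⟨Set.mem_union_left _ hp.1, hp.2⟩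
  unfold posUnits colPosUnits colNegUnits at *
  omega

/-- **`DecoupledVOrder` holds for `𝒲 ⊆ 𝒱`**: then `T1⁻ = ∅`, the `T2⁻` units of `𝒰` are absorbed inside their columns and the
`T3⁻` units of `𝒳` by Theorem A with source side `b`, `G = H = 𝒲`, side function `σ(c) = [c ∈ 𝒱]` (`triT_robust_le_b`), whose
targets are `T3⁺(𝒳)` and a part of `T1⁺(𝒳)`. [this work] -/
theorem decoupledVOrder_of_superset (τ : Set ι) {𝒱 𝒲 : Set (Set ι)} {𝒳 𝒰 : Set (Set ι × Set ι)}
    (h𝒱 : IsUpperSet 𝒱) (h𝒲 : IsUpperSet 𝒲) (h𝒳 : IsUpperSet 𝒳) (h𝒰 : ∀ b : Set ι, IsUpperSet {a : Set ι | (a, b) ∈ 𝒰}) (hsub : 𝒲 ⊆ 𝒱) :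
    rowNegUnits τ 𝒱 𝒲 𝒳 + colNegUnits τ 𝒱 𝒲 𝒰 ≤ posUnits τ 𝒱 𝒲 (𝒳 ∪ 𝒰) := by
  -- Theorem A, side b, G = H = 𝒲, σ = [· ∈ 𝒱]
  have hA := triT_robust_le_b τ h𝒳 h𝒲 h𝒲 (fun c => decide (c ∈ 𝒱))
  have eN : rowNegUnits τ 𝒱 𝒲 𝒳 = triT τ (fun a b c => (a, b) ∈ 𝒳 ∧ c ∈ 𝒲 ∧ b ∉ 𝒲) := by
    unfold rowNegUnits
    exact triT_congr fun a b c => ⟨fun h => ⟨h.1, h.2.1.2, h.2.2⟩, fun h => ⟨h.1, ⟨hsub h.2.1, h.2.1⟩, h.2.2⟩⟩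
  have sA := triT_and_add_triT_and_not τ
    (fun a b c => (a, b) ∈ 𝒳 ∧ c ∉ 𝒲 ∧ (if decide (c ∈ 𝒱) then b ∈ 𝒲 else a ∈ 𝒲)) (fun _ _ c => c ∈ 𝒱)
  have hP1 : triT τ (fun a b c => ((a, b) ∈ 𝒳 ∧ c ∉ 𝒲 ∧ (if decide (c ∈ 𝒱) then b ∈ 𝒲 else a ∈ 𝒲)) ∧ c ∈ 𝒱) ≤
      rowPosUnits τ 𝒱 𝒲 (𝒳 ∪ 𝒰) := by
    unfold rowPosUnits
    refine triT_mono τ fun a b c h => ?_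
    obtain ⟨⟨hx, hcW, hif⟩, hcV⟩ := h
    simp only [hcV, decide_true, if_true] at hif
    exact ⟨Set.mem_union_left _ hx, ⟨hcV, hcW⟩, hif⟩
  have hP2 : triT τ (fun a b c => ((a, b) ∈ 𝒳 ∧ c ∉ 𝒲 ∧ (if decide (c ∈ 𝒱) then b ∈ 𝒲 else a ∈ 𝒲)) ∧ ¬ c ∈ 𝒱) ≤
      triT τ (fun a b c => (a, b) ∈ 𝒳 ∪ 𝒰 ∧ (a ∈ 𝒱 ∧ a ∈ 𝒲) ∧ c ∉ 𝒱) := by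
    refine triT_mono τ fun a b c h => ?_
    obtain ⟨⟨hx, hcW, hif⟩, hcV⟩ := h
    simp only [hcV, decide_false] at hif
    exact ⟨Set.mem_union_left _ hx, ⟨hsub hif, hif⟩, hcV⟩
  -- `T2⁻(𝒰) ≤ T2⁺(𝒰)` by one column move, and `T1⁻(𝒰) = 0`
  have c0 : triT τ (fun a b c => (a, b) ∈ 𝒰 ∧ (a ∈ 𝒲 ∧ a ∉ 𝒱) ∧ c ∈ 𝒱) = 0 :=
    triT_eq_zero τ fun a b c h => h.2.1.2 (hsub h.2.1.1)
  have hA2 : ∀ b : Set ι, IsUpperSet {a : Set ι | (a, b) ∈ 𝒰 ∧ a ∈ 𝒱} :=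
    fun b a a' hle ha => ⟨h𝒰 b hle ha.1, h𝒱 hle ha.2⟩
  have m2 := triT_col_le τ (fun b => {a : Set ι | (a, b) ∈ 𝒰 ∧ a ∈ 𝒱}) hA2 h𝒲
  have m2' : triT τ (fun a b c => (a, b) ∈ 𝒰 ∧ a ∈ 𝒱 ∧ c ∈ 𝒲) ≤ triT τ (fun a b _ => (a, b) ∈ 𝒰 ∧ a ∈ 𝒱 ∧ a ∈ 𝒲) := by
    refine le_trans (le_of_eq (triT_congr fun a b c => ?_)) (le_trans m2 (le_of_eq (triT_congr fun a b c => ?_)))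
    · simp only [Set.mem_setOf_eq]; tauto
    · simp only [Set.mem_setOf_eq]; tauto
  have s3 := triT_and_add_triT_and_not τ (fun a b _ => (a, b) ∈ 𝒰 ∧ a ∈ 𝒱 ∧ a ∈ 𝒲) (fun _ _ c => c ∈ 𝒲)
  have s4 := triT_and_add_triT_and_not τ (fun a b c => (a, b) ∈ 𝒰 ∧ a ∈ 𝒱 ∧ c ∈ 𝒲) (fun a _ _ => a ∈ 𝒲)
  have e4 : triT τ (fun a b c => ((a, b) ∈ 𝒰 ∧ a ∈ 𝒱 ∧ c ∈ 𝒲) ∧ a ∈ 𝒲) =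
      triT τ (fun a b c => ((a, b) ∈ 𝒰 ∧ a ∈ 𝒱 ∧ a ∈ 𝒲) ∧ c ∈ 𝒲) := triT_congr fun a b c => by tauto
  have e4' : triT τ (fun a b c => ((a, b) ∈ 𝒰 ∧ a ∈ 𝒱 ∧ c ∈ 𝒲) ∧ ¬ a ∈ 𝒲) =
      triT τ (fun a b c => (a, b) ∈ 𝒰 ∧ (a ∈ 𝒱 ∧ a ∉ 𝒲) ∧ c ∈ 𝒲) := triT_congr fun a b c => by tauto
  have e3' : triT τ (fun a b c => ((a, b) ∈ 𝒰 ∧ a ∈ 𝒱 ∧ a ∈ 𝒲) ∧ ¬ c ∈ 𝒲) =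
      triT τ (fun a b c => (a, b) ∈ 𝒰 ∧ (a ∈ 𝒱 ∧ a ∈ 𝒲) ∧ c ∉ 𝒲) := triT_congr fun a b c => by tauto
  rw [e3'] at s3
  rw [e4, e4'] at s4
  have t2 : triT τ (fun a b c => (a, b) ∈ 𝒰 ∧ (a ∈ 𝒱 ∧ a ∈ 𝒲) ∧ c ∉ 𝒲) ≤
      triT τ (fun a b c => (a, b) ∈ 𝒳 ∪ 𝒰 ∧ (a ∈ 𝒱 ∧ a ∈ 𝒲) ∧ c ∉ 𝒲) :=
    triT_mono τ fun a b c hp => ⟨Set.mem_union_right _ hp.1, hp.2⟩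
  rw [eN]
  unfold posUnits colPosUnits colNegUnits at *
  omega

end

end Summit.CriticalPhenomena.PercolationContinuityZ3.Theorems.ThreePartition
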